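import Summits.QuantumFields.BalabanUV.Beta.D1BFx.PackedLettersAtSites

/-!
# `BalabanUV.Beta.D1BFx.PeriodicArrayWrapNamed` — road «BF-x» for binder row D1, slot (K), chain step (I) «(A1)-PACKED», brick «WRAP-LIMIT», part 4
# «WRAP SOCKETS AT THE NAMED TABLE»: the slice-summed WRAP letters of `PeriodicArrayWrapColH` §3 — the `s`-UNIFORM bi-localisation of the limit table,
# the EXPLICIT wrap-around tail of the slice sum, and the ENTRYWISE limit — transported to the Literature's bi-vertex `SecondOrderResponse.vertex2OfK K n S₂ μ y ν y′`
# through the owner's naming lemma `PackedLettersAtSites.vertex2OfK_eq_sliceSum` ((B3) PART 3a §4), for ANY decaying packed resolvent `K` (the road's `G₀` and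
# its N-leg `NlegRoad m a` alike) — the supplier shape the N side and the (S-LIT) ∕ (S-M2) consumers read (owner d1-p2 g18, W-d1p2-g18-1).

HONEST DEPENDENCY (cell records, verbatim): «continuum YM on T⁴ ⇐ BetaPertH ∧ nine spine estimates (0/9 proved); BetaPertH ⇐ (D1) ∧ (D4) ∧
CAP+tail; G-an2-4 gates asym, D1 and NE2/3/4.»  HONEST FRAMING (cell contract, verbatim): «discharging `BetaPertH` makes Bałaban's UV stability
UNCONDITIONAL — a real constructive-QFT result; it is NOT the continuum limit and NOT the Clay problem.»  THIS MODULE DISCHARGES NOTHING of (K),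
of D1 or of the wall: [folklore] finite-sum bookkeeping over the `(d+1)²` slices of `PeriodicArrayWrapColH.abs_wsum_images_colH_sub_le` and three rewrites
along `vertex2OfK_eq_sliceSum`.  No definition, no `def … : Prop`, nothing cited, 0 sorry.  0 root-level binders of row D1 discharged; (K) NOT closed; NOT D1,
NOT `BetaPertH`, NOT continuum, NOT Clay.

ABSOLUTE RULE (cell charter, verbatim): «No internally-minted statement may enter as a cited fact. Every hypothesis is either kernel-proved in this
package or a verbatim quotation of a PUBLISHED theorem with page reference. The manuscript(s) under audit are NOT citable for their own disputed
steps — they are the thing under adjudication; programme-internal (2001/route/tribunal) claims are never citable.»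

WHY (owner d1-p2 g18, W-d1p2-g18-1 l.40409 «§2 … IS the right supplier shape for the N side and for the (S-LIT)∕(S-M2) consumers — GO … AFTER PART 3a
lands»).  (B3) PART 3b `PackedLiteralCombine` v1.1 concludes `hessKer G₀ (vertexOfK G₀ (m+1) S) (vertex2OfK G₀ (m+1) S₂) μ ν z + …`, the limit table fed to
(B6′) as the slice sum and renamed at the end.  A consumer that STARTS from the name — the N side once `S₂,N` is named (`K := NlegRoad m a`), the (S-LIT)
junction reading `JetData`'s `W := vertex2OfK …`, an (S-M2) rate reader — wants (B6′)'s `hlimWM` with the limit ALREADY `vertex2OfK K n S₂ μ y ν y′ x z a b`,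
the limit table's `BiLoc` socket under that name, and the wrap tail with an explicit `s`-rate.  THIS FILE gives exactly those three, `s`-free data.

CONTENT (all [folklore]; `K : MKer (d+1) (Fib d)` with `Decays K C δK`, `0 ≤ C`; `LocStencil₂ S₂ Ck δ` (≡ the body `∀ κ u κ′ u′, BiLoc (S₂ κ u κ′ u′) u u (Ck·e^{−δ|u′−u|₁}) δ`
displayed in `PeriodicArrayWrapColH`, by `rfl`); `0 < δ ≤ δK`; `𝒲^{(s)}` = the slice-summed one-periodised table `fun x z a b => Σ_{κ′} Σ_{κ″} wsum (colH K n μ y κ′)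
(u ↦ wsum (u″ ↦ Σ'_m colH K n ν y′ κ″ (u″ + s·m)) (S₂ κ′ u κ″)) x z a b`).
* §1 `abs_slices_sub_le` (finite-sum bookkeeping), **`abs_sliceSum_images_colH_sub_le`**: for every `s ≥ 1` and every entry,
  `|𝒲^{(s)} x z a b − (slice-summed plain table) x z a b| ≤ (d+1)²·(C·C·Ck·Zl δ·Zl(δ∕2)·e^{(δ∕2)|z − n·y′|₁}·imageTail (d+1) (δ∕2·s))`.
* §2 at the NAMED table: **`biLoc_vertex2OfK_colH`** `BiLoc (vertex2OfK K n S₂ μ y ν y′) (n•y) (n•y) ((d+1)²·(C·(C·Ck·Zl δ)·Zl(δ∕2))) (δ∕2)` (single centre, rate `δ∕2`;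
  the Literature's two-centre form at rate `δ∕8` is `SecondOrderResponse.vertexFamily₂_vertex2OfK`), **`abs_sliceSum_images_sub_vertex2OfK_le`** (the §1 tail against
  `vertex2OfK K n S₂ μ y ν y′ x z a b`), **`tendsto_sliceSum_images_vertex2OfK`** (`𝒲^{(s)} x z a b → vertex2OfK K n S₂ μ y ν y′ x z a b` as `s → ∞` — (B6′)'s `hlimWM`
  with the named limit; compose with `(k ↦ (m+1)·p k) → ∞` as in PART 3b).
Provenance: G-an2-4 swarm leaf seat `b2b-balaban-gan24-formalise-leaf-05` (gen 52), cross-lane for road «BF-x», 2026-08-22.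
-/

noncomputable section

namespace Summit.QuantumFields.BalabanUV.Beta.D1BFx.PeriodicArrayWrapNamed

open Filter Topology
open scoped BigOperators
open Literature.MathematicalPhysics.QuantumFieldTheory.Balaban1983to89
open Literature.MathematicalPhysics.QuantumFieldTheory.Balaban1983to89.Beta
open B12Sec2to5 (l1 l1_nonneg)
open ExpKernelCalculus (MKer BiLoc Decays Zl)
open OneStepResolventKernel (Fib wsum)
open OneStepKernelFamily (colH)
open BalabanCompositeJets (LocStencil₂ LocStencil₂.nonneg)
open SecondOrderResponse (vertex2OfK)
open Summit.QuantumFields.BalabanUV.Beta.D1BFx.PeriodicArrayWrapColH (abs_wsum_images_colH_sub_le biLoc_sliceSum_plain_colH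
  tendsto_sliceSum_images_colH)
open Summit.QuantumFields.BalabanUV.Beta.D1BFx.PackedLettersAtSites (vertex2OfK_eq_sliceSum)

variable {d : ℕ}

/-! ## §1 The explicit wrap-around tail of the slice sum -/

/-- [folklore] Finite-sum bookkeeping: if every slice difference is `≤ T` in absolute value, the `(d+1)²`-slice double sums differ by at most `(d+1)²·T`. -/
theorem abs_slices_sub_le {A B : Fin (d + 1) → Fin (d + 1) → ℝ} {T : ℝ} (h : ∀ κ' κ'', |A κ' κ'' - B κ' κ''| ≤ T) :
    |∑ κ' : Fin (d + 1), ∑ κ'' : Fin (d + 1), A κ' κ'' - ∑ κ' : Fin (d + 1), ∑ κ'' : Fin (d + 1), B κ' κ''|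
      ≤ (((d + 1 : ℕ) : ℝ)) ^ 2 * T := by
  rw [← Finset.sum_sub_distrib]
  have hrow : ∀ κ' : Fin (d + 1), |∑ κ'' : Fin (d + 1), A κ' κ'' - ∑ κ'' : Fin (d + 1), B κ' κ''| ≤ ((d + 1 : ℕ) : ℝ) * T := by
    intro κ'
    rw [← Finset.sum_sub_distrib]
    calc |∑ κ'' : Fin (d + 1), (A κ' κ'' - B κ' κ'')| ≤ ∑ κ'' : Fin (d + 1), |A κ' κ'' - B κ' κ''| := Finset.abs_sum_le_sum_abs _ _
      _ ≤ ∑ _κ'' : Fin (d + 1), T := Finset.sum_le_sum fun κ'' _ => h κ' κ''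
      _ = _ := by rw [Finset.sum_const, Finset.card_univ, Fintype.card_fin, nsmul_eq_mul]
  calc |∑ κ' : Fin (d + 1), (∑ κ'' : Fin (d + 1), A κ' κ'' - ∑ κ'' : Fin (d + 1), B κ' κ'')|
      ≤ ∑ κ' : Fin (d + 1), |∑ κ'' : Fin (d + 1), A κ' κ'' - ∑ κ'' : Fin (d + 1), B κ' κ''| := Finset.abs_sum_le_sum_abs _ _
    _ ≤ ∑ _κ' : Fin (d + 1), ((d + 1 : ℕ) : ℝ) * T := Finset.sum_le_sum fun κ' _ => hrow κ'
    _ = (((d + 1 : ℕ) : ℝ)) ^ 2 * T := by rw [Finset.sum_const, Finset.card_univ, Fintype.card_fin, nsmul_eq_mul]; ring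

variable {n : ℕ} {K : MKer (d + 1) (Fib d)} {C δK : ℝ}
  {S₂ : Fin (d + 1) → (Fin (d + 1) → ℤ) → Fin (d + 1) → (Fin (d + 1) → ℤ) → MKer (d + 1) (Fib d)} {Ck δ : ℝ}

/-- [folklore] **THE WRAP-AROUND TAIL OF THE SLICE-SUMMED PACKED SECOND TABLE**: for a decaying packed resolvent `K`, a `LocStencil₂` family at a rate `0 < δ ≤ δK`,
every period `s ≥ 1` and every entry,
`|𝒲^{(s)} x z a b − Σ_{κ′} Σ_{κ″} wsum (colH K n μ y κ′) (u ↦ wsum (colH K n ν y′ κ″) (S₂ κ′ u κ″)) x z a b| ≤ (d+1)²·(C·C·Ck·Zl δ·Zl(δ∕2)·e^{(δ∕2)|z − n·y′|₁}·imageTail (d+1) (δ∕2·s))`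
(`PeriodicArrayWrapColH.abs_wsum_images_colH_sub_le` summed over the slices). -/
theorem abs_sliceSum_images_colH_sub_le (hK : Decays K C δK) (hC : 0 ≤ C) (hS₂ : LocStencil₂ S₂ Ck δ) (hδ : 0 < δ) (hδK : δ ≤ δK)
    (s : ℕ) [NeZero s] (μ ν : Fin (d + 1)) (y y' : Fin (d + 1) → ℤ) (x z : Fin (d + 1) → ℤ) (a b : Fib d) :
    |(∑ κ' : Fin (d + 1), ∑ κ'' : Fin (d + 1), wsum (colH K n μ y κ')
          (fun u => wsum (fun u'' => ∑' m : Fin (d + 1) → ℤ, colH K n ν y' κ'' (imageShift s u'' m)) (S₂ κ' u κ'')) x z a b)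
        - ∑ κ' : Fin (d + 1), ∑ κ'' : Fin (d + 1), wsum (colH K n μ y κ') (fun u => wsum (colH K n ν y' κ'') (S₂ κ' u κ'')) x z a b|
      ≤ (((d + 1 : ℕ) : ℝ)) ^ 2 * (C * C * Ck * Zl (d + 1) δ * Zl (d + 1) (δ / 2) * Real.exp (δ / 2 * l1 (z - (n : ℤ) • y'))
          * imageTail (d + 1) (δ / 2 * s)) :=
  abs_slices_sub_le fun κ' κ'' => abs_wsum_images_colH_sub_le hK hC hS₂ hδ hδK s μ ν y y' κ' κ'' x z a b

/-! ## §2 The WRAP sockets at the named table `vertex2OfK K n S₂ μ y ν y′` -/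

/-- [folklore] **THE BI-VERTEX IS BI-LOCALISED AT THE FIRST COARSE BOND** (single centre, rate `δ∕2`): `BiLoc (vertex2OfK K n S₂ μ y ν y′) (n•y) (n•y)
((d+1)²·(C·(C·Ck·Zl δ)·Zl(δ∕2))) (δ∕2)` — `PeriodicArrayWrapColH.biLoc_sliceSum_plain_colH` read at the name `vertex2OfK_eq_sliceSum` gives (the Literature's
two-centre form at rate `δ∕8` is `SecondOrderResponse.vertexFamily₂_vertex2OfK`; re-centre with `KernelWard.biLoc_recentre` as needed). -/
theorem biLoc_vertex2OfK_colH (hK : Decays K C δK) (hC : 0 ≤ C) (hS₂ : LocStencil₂ S₂ Ck δ) (hδ : 0 < δ) (hδK : δ ≤ δK)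
    (μ ν : Fin (d + 1)) (y y' : Fin (d + 1) → ℤ) :
    BiLoc (vertex2OfK K n S₂ μ y ν y') ((n : ℤ) • y) ((n : ℤ) • y)
      ((((d + 1 : ℕ) : ℝ)) ^ 2 * (C * (C * Ck * Zl (d + 1) δ) * Zl (d + 1) (δ / 2))) (δ / 2) := by
  rw [vertex2OfK_eq_sliceSum hK hC hS₂ hS₂.nonneg hδ hδK μ y ν y']
  exact biLoc_sliceSum_plain_colH hK hC hS₂ hδ hδK μ ν y y'

/-- [folklore] **THE WRAP-AROUND TAIL AGAINST THE NAMED LIMIT**: for every `s ≥ 1` and every entry,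
`|𝒲^{(s)} x z a b − vertex2OfK K n S₂ μ y ν y′ x z a b| ≤ (d+1)²·(C·C·Ck·Zl δ·Zl(δ∕2)·e^{(δ∕2)|z − n·y′|₁}·imageTail (d+1) (δ∕2·s))` — an explicit `s`-rate
(`imageTail (d+1) (δ∕2·s) → 0`, `VolumeImages.tendsto_imageTail_side`). -/
theorem abs_sliceSum_images_sub_vertex2OfK_le (hK : Decays K C δK) (hC : 0 ≤ C) (hS₂ : LocStencil₂ S₂ Ck δ) (hδ : 0 < δ) (hδK : δ ≤ δK)
    (s : ℕ) [NeZero s] (μ ν : Fin (d + 1)) (y y' : Fin (d + 1) → ℤ) (x z : Fin (d + 1) → ℤ) (a b : Fib d) :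
    |(∑ κ' : Fin (d + 1), ∑ κ'' : Fin (d + 1), wsum (colH K n μ y κ')
          (fun u => wsum (fun u'' => ∑' m : Fin (d + 1) → ℤ, colH K n ν y' κ'' (imageShift s u'' m)) (S₂ κ' u κ'')) x z a b)
        - vertex2OfK K n S₂ μ y ν y' x z a b|
      ≤ (((d + 1 : ℕ) : ℝ)) ^ 2 * (C * C * Ck * Zl (d + 1) δ * Zl (d + 1) (δ / 2) * Real.exp (δ / 2 * l1 (z - (n : ℤ) • y'))
          * imageTail (d + 1) (δ / 2 * s)) := by
  rw [vertex2OfK_eq_sliceSum hK hC hS₂ hS₂.nonneg hδ hδK μ y ν y']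
  exact abs_sliceSum_images_colH_sub_le hK hC hS₂ hδ hδK s μ ν y y' x z a b

/-- [folklore] **«WRAP-LIMIT» WITH THE NAMED LIMIT** ((B6′)'s `hlimWM` when `𝒲M∞ := vertex2OfK K n S₂`): entrywise, as `s → ∞`,
`𝒲^{(s)} x z a b → vertex2OfK K n S₂ μ y ν y′ x z a b`. -/
theorem tendsto_sliceSum_images_vertex2OfK (hK : Decays K C δK) (hC : 0 ≤ C) (hS₂ : LocStencil₂ S₂ Ck δ) (hδ : 0 < δ) (hδK : δ ≤ δK)
    (μ ν : Fin (d + 1)) (y y' : Fin (d + 1) → ℤ) (x z : Fin (d + 1) → ℤ) (a b : Fib d) :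
    Tendsto (fun s : ℕ => ∑ κ' : Fin (d + 1), ∑ κ'' : Fin (d + 1),
        wsum (colH K n μ y κ') (fun u => wsum (fun u'' => ∑' m : Fin (d + 1) → ℤ, colH K n ν y' κ'' (imageShift s u'' m)) (S₂ κ' u κ'')) x z a b)
      atTop (𝓝 (vertex2OfK K n S₂ μ y ν y' x z a b)) := by
  rw [vertex2OfK_eq_sliceSum hK hC hS₂ hS₂.nonneg hδ hδK μ y ν y']
  exact tendsto_sliceSum_images_colH hK hC hS₂ hδ hδK μ ν y y' x z a b

end Summit.QuantumFields.BalabanUV.Beta.D1BFx.PeriodicArrayWrapNamed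

end
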